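import Literature.Topology.Immersions.WrinkledEmbeddingsRoundCollarTransversalRotation
import Literature.Geometry.Riemannian.ChernGaussBonnetFourProofs
import Literature.Topology.FourManifolds.MorseChartChange
import Literature.Topology.FourManifolds.MorseExistence
import Literature.Topology.FourManifolds.MorseAffine
import Literature.Topology.FourManifolds.SphereMorseCount
import Literature.Topology.FourManifolds.CompatibleOrientationRestrict
import Literature.AlgebraicTopology.SingularHomology.LocalisationAdditivity
import Mathlib.Analysis.Calculus.FDeriv.Symmetric
import HarnessLib

/-!
# Hopf's curvatura integra theorem in dimension four, `χ(X) = 2 deg ν`, and the discharge of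
# `hasTransversalRotation_of_homotopyEquiv_sphere_four`

Topic `Literature/Topology/Immersions` (fact seat
`provefact-Literature.Topology.Immersions.hasTransv-b92b6b93a7`; sibling of
`WrinkledEmbeddingsRoundCollarTransversalRotation.lean`, which reduced the named fact
`Literature.Topology.Immersions.hasTransversalRotation_of_homotopyEquiv_sphere_four` of
`WrinkledEmbeddingsRoundCollar.lean` to Hopf's curvatura integra theorem,
`hasTransversalRotation_of_homotopyEquiv_sphere_four_of_gauss`).  Everything here is **proved**;
no named facts.

**Theorem** (H. Hopf, Math. Ann. 96 (1927); Guillemin–Pollack, *Differential Topology* (1974),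
Ch. 4 §9, Theorem p. 198: *"for even-dimensional [compact hypersurfaces `X ⊂ ℝᵏ⁺¹`] the Euler
characteristic equals twice the degree of the Gauss map"*), here for `k = 4` and for
immersions: `two_mul_degree_gauss_eq_relEuler` — for a `C^∞` immersion `F : X⁴ → ℝ⁵` of a closed
connected oriented `4`-manifold with Gauss map `ν̄ : X → S⁴` (the oriented unit normal) of
degree `d` (`S⁴` oriented by its outward normal, homological orientations compatible),
`2 d = χ(X) = relEuler ℤ ℤ X ∅`.

We follow the printed proof (Guillemin–Pollack pp. 196–198):

1. *Height functions.*  For a unit vector `a`, the height function `h_a = ⟪a, F⟫` has critical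
   points exactly `ν̄⁻¹(a) ∪ ν̄⁻¹(−a)` (`isMCriticalPt_height_iff_orientedNormal`), and for almost
   every `a` it is a Morse function (the tree's `ae_isMorse_height`, Guillemin–Pollack Ch. 1 §7):
   `exists_unit_isMorse_height`.
2. *Hessian versus shape operator* (p. 197).  In a chart, differentiating `⟪ν, DF⟫ = 0` gives
   `Hess h_a = ∓⟪Dν, DF⟫ = G(∓L ·, ·)` with `G` the first fundamental form and `L` the shape
   operator (`inner_fderiv_fderiv_eq_neg`, `shapeOp`, `det_shapeOp_sign`); by Sylvester's law
   (the tree's `det_div_abs_det_eq_neg_one_pow_sigNeg_general`; dimension `4` is even)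
   `sign det L = (−1)^{index}` at a nondegenerate critical point (`det_chartShapeOp_sign`).
3. *Local degree of the Gauss map* (p. 196: `T_pX` and `T_{ν(p)}S⁴` are the same oriented
   hyperplane).  `sign det L = +1` exactly when `ν̄` preserves the orientations at `p`
   (`sign_det_chartShapeOp_iff`, a cross-product computation with the oriented normals of `X` and
   of `S⁴`), so `ν̄` — a local diffeomorphism near `p`, `exists_opens_injective_gauss` — carries
   the local orientation class at `p` to `sign det L` times that at `ν̄ p` (`localDegree_gauss`;
   the tree's `map_localClass_eq_of_isCompatibleAt`, `IsCompatible.neg`, `restrictOpens`).  The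
   Gauss map is `Cᵏ` for `F ∈ C^{k+1}` (`contMDiffAt_orientedNormal`).
4. *Degree as a sum of local degrees* (Hatcher 2002, Prop. 2.30):
   `HasDegree.eq_sum_of_localDegree`, from the tree's localisation formula
   `eq_sum_of_forall_map_eq_restrictLocal` applied to the fundamental class along a finite fibre.
5. *Counting* (p. 198).  Applying 4. at `a` and at `−a`, `2d = Σ_{crit h_a} (−1)^{index} = χ(X)`
   by the Morse equality of the tree (`SphereMorseCount.morseCount_eq_relEuler`; Milnor 1965,
   Thm. 7.4, Hirsch Ch. 6 Thm. 3.5).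

Finally `hasTransversalRotation_of_homotopyEquiv_sphere_four_holds` discharges the named fact
through `hasTransversalRotation_of_homotopyEquiv_sphere_four_of_gauss`.

## References

* H. Hopf, *Vektorfelder in n-dimensionalen Mannigfaltigkeiten*, Math. Ann. 96 (1927) 225–250.
* V. Guillemin, A. Pollack, *Differential Topology*, Prentice–Hall (1974), Ch. 1 §7, Ch. 4 §9
  pp. 194–198. [GuilleminPollack1974]
* J. Milnor, *Morse theory* (1963), §6; *Lectures on the h-cobordism theorem* (1965), Thm. 7.4.
* A. Hatcher, *Algebraic Topology*, CUP (2002), Prop. 2.30, §3.3. [HatcherAT2002]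
* G. E. Bredon, *Topology and Geometry* (1993), VI.7 Thm. 7.15. [Bredon1993]
-/

noncomputable section

open scoped Manifold ContDiff Topology InnerProductSpace RealInnerProductSpace
open Set Function Filter Module

namespace Literature.Topology.Immersions

open Literature.Topology.FourManifolds Literature.AlgebraicTopology.SingularHomology

local notation "𝔼" n:max => EuclideanSpace ℝ (Fin n)

local notation "𝕊⁴" => (Metric.sphere (0 : EuclideanSpace ℝ (Fin 5)) 1)



section HeightHessian

variable {E : Type*} [NormedAddCommGroup E] [NormedSpace ℝ E]

/-- The derivative of a height function `x ↦ ⟪a, g x⟫` is `w ↦ ⟪a, Dg_x w⟫`. [folklore] -/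
theorem hasFDerivAt_inner_const_comp {g : E → 𝔼 5} {g' : E →L[ℝ] 𝔼 5} {x : E}
    (hg : HasFDerivAt g g' x) (a : 𝔼 5) :
    HasFDerivAt (fun y => ⟪a, g y⟫_ℝ) ((innerSL ℝ a).comp g') x :=
  (innerSL ℝ a).hasFDerivAt.comp x hg

/-- The second derivative of a height function `x ↦ ⟪a, g x⟫` is `(v, w) ↦ ⟪a, D²g_x v w⟫`.
[folklore] -/
theorem fderiv_fderiv_inner_const_comp {g : E → 𝔼 5} {x : E} {s : Set E} (hs : s ∈ 𝓝 x)
    (hg : DifferentiableOn ℝ g s) (hg2 : DifferentiableAt ℝ (fderiv ℝ g) x) (a : 𝔼 5) (v w : E) :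
    fderiv ℝ (fderiv ℝ fun y => ⟪a, g y⟫_ℝ) x v w = ⟪a, fderiv ℝ (fderiv ℝ g) x v w⟫_ℝ := by
  -- near `x`, `D⟪a, g⟫ = (innerSL a) ∘L Dg`
  have heq : (fderiv ℝ fun y => ⟪a, g y⟫_ℝ) =ᶠ[𝓝 x] fun y => (innerSL ℝ a).comp (fderiv ℝ g y) := by
    obtain ⟨U, hUs, hU, hxU⟩ := _root_.mem_nhds_iff.1 hs
    filter_upwards [hU.mem_nhds hxU] with y hy
    have hgy : DifferentiableAt ℝ g y := (hg y (hUs hy)).differentiableAt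
      (Filter.mem_of_superset (hU.mem_nhds hy) hUs)
    exact (hasFDerivAt_inner_const_comp hgy.hasFDerivAt a).fderiv
  rw [heq.fderiv_eq]
  -- differentiate `y ↦ (innerSL a) ∘L (Dg y)`: post-composition by a fixed continuous linear map
  have h2 : HasFDerivAt (fun y => (innerSL ℝ a).comp (fderiv ℝ g y))
      (((ContinuousLinearMap.compL ℝ E (𝔼 5) ℝ) (innerSL ℝ a)).comp (fderiv ℝ (fderiv ℝ g) x)) x :=
    ((ContinuousLinearMap.compL ℝ E (𝔼 5) ℝ) (innerSL ℝ a)).hasFDerivAt.comp x hg2.hasFDerivAt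
  rw [h2.fderiv]
  rfl

/-- **Differentiating `⟪ν, Dg w⟫ = 0`**: if `ν` is normal to the image of `Dg` near `x`, then
`⟪ν x, D²g_x v w⟫ = -⟪Dν_x v, Dg_x w⟫`. [folklore] -/
theorem inner_fderiv_fderiv_eq_neg {g : E → 𝔼 5} {ν : E → 𝔼 5} {x : E} {s : Set E} (hs : s ∈ 𝓝 x)
    (hg2 : DifferentiableAt ℝ (fderiv ℝ g) x)
    (hν : DifferentiableAt ℝ ν x) (hperp : ∀ y ∈ s, ∀ w, ⟪ν y, fderiv ℝ g y w⟫_ℝ = 0) (v w : E) :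
    ⟪ν x, fderiv ℝ (fderiv ℝ g) x v w⟫_ℝ = -⟪fderiv ℝ ν x v, fderiv ℝ g x w⟫_ℝ := by
  -- the function `y ↦ ⟪ν y, Dg_y w⟫` vanishes near `x`, so its derivative at `x` vanishes
  have hzero : (fun y => ⟪ν y, fderiv ℝ g y w⟫_ℝ) =ᶠ[𝓝 x] fun _ => (0 : ℝ) := by
    obtain ⟨U, hUs, hU, hxU⟩ := _root_.mem_nhds_iff.1 hs
    filter_upwards [hU.mem_nhds hxU] with y hy
    exact hperp y (hUs hy) w
  have hD0 : fderiv ℝ (fun y => ⟪ν y, fderiv ℝ g y w⟫_ℝ) x = 0 := by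
    rw [hzero.fderiv_eq, fderiv_const_apply]
  -- and by the product rule it is `⟪Dν v, Dg w⟫ + ⟪ν, D²g v w⟫`
  have hgw : HasFDerivAt (fun y => fderiv ℝ g y w)
      ((ContinuousLinearMap.apply ℝ (𝔼 5) w).comp (fderiv ℝ (fderiv ℝ g) x)) x :=
    (ContinuousLinearMap.apply ℝ (𝔼 5) w).hasFDerivAt.comp x hg2.hasFDerivAt
  have hprod := (hν.hasFDerivAt.inner ℝ hgw).fderiv
  have := congrArg (fun φ : E →L[ℝ] ℝ => φ v) hprod
  rw [hD0] at this
  simp only [_root_.zero_apply, ContinuousLinearMap.comp_apply, fderivInnerCLM_apply,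
    ContinuousLinearMap.prod_apply, ContinuousLinearMap.apply_apply] at this
  -- `this : 0 = ⟪ν x, D²g v w⟫ + ⟪Dν v, Dg w⟫`
  linarith

end HeightHessian

/-! ### The shape operator in a chart and the sign of its determinant -/

section Shape

open Module

/-- The image of the differential of an immersion `ℝ⁴ → ℝ⁵` normal to a non-zero vector `n` is
the hyperplane `n^⊥`. [folklore] -/
theorem range_eq_orthogonal_of_inner_eq_zero {D : (𝔼 4) →L[ℝ] 𝔼 5} (hD : Injective D) {n : 𝔼 5}
    (hn : n ≠ 0) (hperp : ∀ w, ⟪n, D w⟫_ℝ = 0) :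
    LinearMap.range D.toLinearMap = (ℝ ∙ n)ᗮ := by
  apply Submodule.eq_of_le_of_finrank_eq
  · rintro _ ⟨w, rfl⟩
    rw [Submodule.mem_orthogonal_singleton_iff_inner_right]
    exact hperp w
  · have h1 : finrank ℝ (LinearMap.range D.toLinearMap) = 4 := by
      rw [LinearMap.finrank_range_of_inj hD, finrank_euclideanSpace_fin]
    have h2 : finrank ℝ (ℝ ∙ n)ᗮ = 4 := by
      have h := Submodule.finrank_add_finrank_orthogonal (ℝ ∙ n)
      rw [finrank_span_singleton hn, finrank_euclideanSpace_fin] at h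
      omega
    rw [h1, h2]

/-- Differentiating `‖ν‖ = 1`: the differential of a unit field is normal to the field.
[folklore] -/
theorem inner_fderiv_self_eq_zero {E : Type*} [NormedAddCommGroup E] [NormedSpace ℝ E]
    {ν : E → 𝔼 5} {x : E} (hν : DifferentiableAt ℝ ν x) (hunit : ∀ᶠ y in 𝓝 x, ‖ν y‖ = 1)
    (v : E) : ⟪ν x, fderiv ℝ ν x v⟫_ℝ = 0 := by
  have hconst : (fun y => ⟪ν y, ν y⟫_ℝ) =ᶠ[𝓝 x] fun _ => (1 : ℝ) := by
    filter_upwards [hunit] with y hy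
    rw [real_inner_self_eq_norm_sq, hy, one_pow]
  have hD0 : fderiv ℝ (fun y => ⟪ν y, ν y⟫_ℝ) x = 0 := by
    rw [hconst.fderiv_eq, fderiv_const_apply]
  have hprod := (hν.hasFDerivAt.inner ℝ hν.hasFDerivAt).fderiv
  have := congrArg (fun φ : E →L[ℝ] ℝ => φ v) hprod
  rw [hD0] at this
  simp only [_root_.zero_apply, ContinuousLinearMap.comp_apply, fderivInnerCLM_apply,
    ContinuousLinearMap.prod_apply] at this
  linarith [real_inner_comm (ν x) (fderiv ℝ ν x v)]

/-- **The shape operator in a chart.**  For an immersion `g : ℝ⁴ → ℝ⁵` with unit normal field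
`ν`, the differential `Dν_c` takes values in `Dg_c(ℝ⁴) = ν(c)^⊥`; `shapeOp` is the endomorphism
`L` of `ℝ⁴` with `Dg_c ∘ L = Dν_c` (the Weingarten map read in the frame `Dg_c`).
[folklore] -/
def shapeOp (D N : (𝔼 4) →L[ℝ] 𝔼 5) (hD : Injective D)
    (hN : ∀ v, N v ∈ LinearMap.range D.toLinearMap) : (𝔼 4) →ₗ[ℝ] 𝔼 4 :=
  (LinearEquiv.ofInjective D.toLinearMap hD).symm.toLinearMap ∘ₗ
    LinearMap.codRestrict (LinearMap.range D.toLinearMap) N.toLinearMap hN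

/-- Defining property of the shape operator: `Dg (L v) = Dν v`. [folklore] -/
theorem apply_shapeOp (D N : (𝔼 4) →L[ℝ] 𝔼 5) (hD : Injective D)
    (hN : ∀ v, N v ∈ LinearMap.range D.toLinearMap) (v : 𝔼 4) :
    D (shapeOp D N hD hN v) = N v := by
  show D.toLinearMap ((LinearEquiv.ofInjective D.toLinearMap hD).symm
    (LinearMap.codRestrict (LinearMap.range D.toLinearMap) N.toLinearMap hN v)) = N v
  rw [← LinearEquiv.ofInjective_apply D.toLinearMap (h := hD), LinearEquiv.apply_symm_apply]
  rfl

/-- **Hessian of the height function versus the shape operator** (Guillemin–Pollack 1974,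
Ch. 4 §9, p. 197; Milnor 1963, §6): at a point `c` where the unit normal is `ν(c) = σ a`
(`σ = ±1`), the second derivative `B` of the height function `⟪a, g⟫` is `B(v, w) = G(−σ L v, w)`
with `G` the first fundamental form and `L` the shape operator; consequently, if `B` is
nondegenerate, `det L ≠ 0` and `sign det L = (−1)^{index B}`
(`det_div_abs_det_eq_neg_one_pow_sigNeg_general`, dimension `4` being even).
[cite: GuilleminPollack1974, Ch. 4 §9 p. 197] -/
theorem det_shapeOp_sign {g ν : (𝔼 4) → 𝔼 5} {c : 𝔼 4} {s : Set (𝔼 4)} (hs : s ∈ 𝓝 c)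
    (hg : DifferentiableOn ℝ g s) (hg2 : DifferentiableAt ℝ (fderiv ℝ g) c)
    (hDinj : Injective (fderiv ℝ g c)) (hν : DifferentiableAt ℝ ν c)
    (hperp : ∀ y ∈ s, ∀ w, ⟪ν y, fderiv ℝ g y w⟫_ℝ = 0)
    (hN : ∀ v, fderiv ℝ ν c v ∈ LinearMap.range (fderiv ℝ g c).toLinearMap)
    {σ : ℝ} (hσ : σ = 1 ∨ σ = -1) {B : LinearMap.BilinForm ℝ (𝔼 4)}
    (hB : ∀ v w, B v w = fderiv ℝ (fderiv ℝ fun y => ⟪σ • ν c, g y⟫_ℝ) c v w)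
    (hBs : B.IsSymm) (hBn : B.Nondegenerate) :
    LinearMap.det (shapeOp (fderiv ℝ g c) (fderiv ℝ ν c) hDinj hN) ≠ 0 ∧
      LinearMap.det (shapeOp (fderiv ℝ g c) (fderiv ℝ ν c) hDinj hN) /
          |LinearMap.det (shapeOp (fderiv ℝ g c) (fderiv ℝ ν c) hDinj hN)| =
        (-1 : ℝ) ^ sigNeg B.toQuadraticMap := by
  -- the first fundamental form
  let G : LinearMap.BilinForm ℝ (𝔼 4) := LinearMap.mk₂ ℝ
    (fun v w => ⟪fderiv ℝ g c v, fderiv ℝ g c w⟫_ℝ)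
    (fun v v' w => by rw [map_add, inner_add_left])
    (fun r v w => by rw [map_smul, real_inner_smul_left, smul_eq_mul])
    (fun v w w' => by rw [map_add, inner_add_right])
    (fun r v w => by rw [map_smul, real_inner_smul_right, smul_eq_mul])
  have hGapply : ∀ v w, G v w = ⟪fderiv ℝ g c v, fderiv ℝ g c w⟫_ℝ := fun v w => rfl
  have hGs : ∀ v w, G v w = G w v := fun v w => by rw [hGapply, hGapply, real_inner_comm]
  have hGp : ∀ v, v ≠ 0 → 0 < G v v := fun v hv => by
    rw [hGapply, real_inner_self_eq_norm_sq]
    have : fderiv ℝ g c v ≠ 0 := fun h0 => hv (hDinj (by rw [h0, map_zero]))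
    positivity
  -- `B(v, w) = G(−σ L v, w)`
  have hBG : ∀ v w, B v w =
      G (((-σ) • shapeOp (fderiv ℝ g c) (fderiv ℝ ν c) hDinj hN) v) w := fun v w => by
    rw [hB, fderiv_fderiv_inner_const_comp hs hg hg2, inner_smul_left,
      inner_fderiv_fderiv_eq_neg hs hg2 hν hperp, hGapply, LinearMap.smul_apply, map_smul,
      real_inner_smul_left, apply_shapeOp]
    simp only [conj_trivial]
    ring
  obtain ⟨h0, hsign⟩ := Literature.Geometry.Riemannian.det_div_abs_det_eq_neg_one_pow_sigNeg_general
    G hGs hGp ((-σ) • shapeOp (fderiv ℝ g c) (fderiv ℝ ν c) hDinj hN) hBG hBs hBn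
  have hdet : LinearMap.det ((-σ) • shapeOp (fderiv ℝ g c) (fderiv ℝ ν c) hDinj hN) =
      LinearMap.det (shapeOp (fderiv ℝ g c) (fderiv ℝ ν c) hDinj hN) := by
    rw [LinearMap.det_smul, finrank_euclideanSpace_fin]
    rcases hσ with rfl | rfl <;> norm_num
  rw [hdet] at h0 hsign
  exact ⟨h0, hsign⟩

end Shape





section NormalSmooth

variable {n : ℕ} {M : Type*} [TopologicalSpace M] [ChartedSpace (𝔼 n) M] [IsManifold (𝓡 n) ∞ M]
  {F : M → 𝔼 (n+1)}

/-- **Smoothness of the oriented normal** (Hirsch 1976, Ch. 4 §4; the local formula of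
`continuous_orientedNormal`): for `F` of class `C^{k+1}` with injective differential, the oriented
unit normal `orientedNormal o F : M → ℝⁿ⁺¹` is of class `Cᵏ`.  At `x₀` it equals
`ε • ‖c̃‖⁻¹ • c̃` near `x₀`, where `c̃ y = vecCross (A y e₀, …)` and `A y` is the differential of
`F` in the tangent coordinates of the chart at `x₀`, a `Cᵏ` function of `y`
(`ContMDiffAt.mfderiv_const`). [cite: HirschDT1976, Ch. 4 §4] -/
theorem contMDiffAt_orientedNormal (o : SmoothOrientation (𝓡 n) M) {k : ℕ}
    (hF : ContMDiff (𝓡 n) (𝓡 (n+1)) (k + 1) F) (hinj : ∀ x, Injective (mfderivE F x)) (x₀ : M) :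
    ContMDiffAt (𝓡 n) 𝓘(ℝ, 𝔼 (n+1)) k (orientedNormal o F) x₀ := by
  -- the differential in the tangent coordinates of the chart at `x₀`
  set A : M → 𝔼 n →L[ℝ] 𝔼 (n+1) :=
    inTangentCoordinates (𝓡 n) (𝓡 (n+1)) id F (mfderiv (𝓡 n) (𝓡 (n+1)) F) x₀ with hA
  have hAc : ContMDiffAt (𝓡 n) 𝓘(ℝ, 𝔼 n →L[ℝ] 𝔼 (n+1)) k A x₀ :=
    (hF x₀).mfderiv_const (m := k) (by norm_cast)
  -- chart change `T_y : y → x₀`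
  set T : M → 𝔼 n →L[ℝ] 𝔼 n := fun y => tangentCoordChange (𝓡 n) y x₀ y with hT
  have hmem : ∀ᶠ y in 𝓝 x₀, y ∈ (chartAt (𝔼 n) x₀).source :=
    (chartAt (𝔼 n) x₀).open_source.mem_nhds (mem_chart_source (𝔼 n) x₀)
  -- `dF_y = A y ∘ T_y`
  have hAT : ∀ᶠ y in 𝓝 x₀, ∀ u, mfderivE F y u = A y (T y u) := by
    filter_upwards [hmem] with y hy u
    have hy' : y ∈ (extChartAt (𝓡 n) y).source ∩ (extChartAt (𝓡 n) x₀).source ∩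
        (extChartAt (𝓡 n) y).source := by
      simp only [extChartAt_source, mem_inter_iff, mem_chart_source, hy, and_self]
    rw [hA, inTangentCoordinates_eq _ _ _ (show id y ∈ (chartAt (𝔼 n) (id x₀)).source from hy)
      (by simp)]
    change _ = (tangentBundleCore (𝓡 (n+1)) (𝔼 (n+1))).coordChange (achart (𝔼 (n+1)) (F y))
      (achart (𝔼 (n+1)) (F x₀)) (F y) (mfderivE F y
        (tangentCoordChange (𝓡 n) x₀ y y (tangentCoordChange (𝓡 n) y x₀ y u)))
    rw [tangentBundleCore_coordChange_model_space, tangentCoordChange_comp hy',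
      tangentCoordChange_self (by simp)]
    rfl
  -- the cross normal read at `x₀`
  set c' : M → 𝔼 (n+1) := fun y => vecCross fun i => A y (EuclideanSpace.single i (1 : ℝ)) with hc'
  have hcc' : ∀ᶠ y in 𝓝 x₀, crossNormal F y =
      LinearMap.det ((T y : 𝔼 n →L[ℝ] 𝔼 n) : 𝔼 n →ₗ[ℝ] 𝔼 n) • c' y := by
    filter_upwards [hAT] with y hy
    rw [crossNormal, hc']
    simp only [hy]
    exact vecCross_comp_eq_det_smul (A y) (T y)
  -- smoothness of `c'`
  have hc'c : ContMDiffAt (𝓡 n) 𝓘(ℝ, 𝔼 (n+1)) k c' x₀ := by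
    have h1 : ContMDiffAt (𝓡 n) 𝓘(ℝ, Fin n → 𝔼 (n+1)) k
        (fun y => fun i : Fin n => A y (EuclideanSpace.single i (1 : ℝ))) x₀ :=
      contMDiffAt_pi_space.2 fun i => hAc.clm_apply contMDiffAt_const
    exact (contDiff_vecCross.of_le (by exact_mod_cast (le_top : (k : ℕ∞) ≤ ⊤))).contDiffAt.comp_contMDiffAt h1
  -- near `x₀` the determinant does not vanish and `c'` does not vanish
  have hne : ∀ᶠ y in 𝓝 x₀, LinearMap.det ((T y : 𝔼 n →L[ℝ] 𝔼 n) : 𝔼 n →ₗ[ℝ] 𝔼 n) ≠ 0 ∧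
      c' y ≠ 0 := by
    filter_upwards [hcc'] with y hy
    have h := crossNormal_ne_zero (hinj y)
    rw [hy] at h
    exact ⟨fun h0 => h (by rw [h0, zero_smul]), fun h0 => h (by rw [h0, smul_zero])⟩
  have hc'0 : c' x₀ ≠ 0 := (hne.self_of_nhds).2
  -- the local formula for the oriented normal
  haveI : IsManifold (𝓡 n) 1 M :=
    IsManifold.of_le (n := ∞) (by exact_mod_cast (le_top : (1 : ℕ∞) ≤ ⊤))
  have hloc : ∀ᶠ y in 𝓝 x₀, orientedNormal o F y =
      (orientationSignStd o x₀ * ‖c' y‖⁻¹) • c' y := by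
    filter_upwards [hcc', hne, orientationSign_mul_det_eventually o x₀] with y hy hy' hsgn
    set d : ℝ := LinearMap.det ((T y : 𝔼 n →L[ℝ] 𝔼 n) : 𝔼 n →ₗ[ℝ] 𝔼 n) with hd
    have hsd : orientationSignStd o y * d = orientationSignStd o x₀ * |d| := hsgn d rfl hy'.1
    have habs : |d| ≠ 0 := abs_ne_zero.2 hy'.1
    rw [orientedNormal, hy, norm_smul, Real.norm_eq_abs, smul_smul]
    congr 1
    calc orientationSignStd o y * (|d| * ‖c' y‖)⁻¹ * d
        = (orientationSignStd o y * d) * |d|⁻¹ * ‖c' y‖⁻¹ := by rw [mul_inv]; ring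
      _ = orientationSignStd o x₀ * |d| * |d|⁻¹ * ‖c' y‖⁻¹ := by rw [hsd]
      _ = orientationSignStd o x₀ * ‖c' y‖⁻¹ := by
          rw [mul_assoc (orientationSignStd o x₀) |d|, mul_inv_cancel₀ habs, mul_one]
  -- conclude
  have hsm : ContMDiffAt (𝓡 n) 𝓘(ℝ, 𝔼 (n+1)) k
      (fun y => (orientationSignStd o x₀ * ‖c' y‖⁻¹) • c' y) x₀ := by
    have hnorm : ContMDiffAt (𝓡 n) 𝓘(ℝ, ℝ) k (fun y => ‖c' y‖) x₀ :=
      (contDiffAt_norm ℝ hc'0).comp_contMDiffAt hc'c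
    have hinv : ContMDiffAt (𝓡 n) 𝓘(ℝ, ℝ) k (fun y => ‖c' y‖⁻¹) x₀ :=
      ContDiffAt.comp_contMDiffAt (g := Inv.inv) (f := fun y => ‖c' y‖) (x := x₀)
        (contDiffAt_inv ℝ (norm_ne_zero_iff.2 hc'0)) hnorm
    have hconst : ContMDiffAt (𝓡 n) 𝓘(ℝ, ℝ) k (fun _ : M => orientationSignStd o x₀) x₀ :=
      contMDiffAt_const
    have h2 := hconst.smul (hinv.smul hc'c)
    refine h2.congr_of_eventuallyEq (Filter.Eventually.of_forall fun y => ?_)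
    show _ = ((fun _ => orientationSignStd o x₀) • ((fun y => ‖c' y‖⁻¹) • c')) y
    simp only [Pi.smul_apply', mul_smul]
  exact hsm.congr_of_eventuallyEq hloc

end NormalSmooth


/-! ### The Hessian of a height function on the manifold versus the shape operator -/

section Wrap

/-- `k ≤ ∞` in `WithTop ℕ∞` for a natural number `k`. [folklore] -/
theorem natCast_le_infty (k : ℕ) : ((k : ℕ) : WithTop ℕ∞) ≤ ∞ := by
  rw [← WithTop.coe_natCast]
  exact WithTop.coe_le_coe.2 le_top

variable {M : Type*} [TopologicalSpace M] [ChartedSpace (𝔼 4) M] [IsManifold (𝓡 4) ∞ M]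
  {F : M → 𝔼 5}

/-- **Chain rule for the chart expression** of a smooth map `F : M → ℝ⁵`:
`D(F ∘ φ⁻¹)(z) = dF ∘ d(φ⁻¹)`. [folklore] -/
theorem fderiv_comp_extChartAt_symm (hF : ContMDiff (𝓡 4) (𝓡 5) ∞ F) (p : M) {z : 𝔼 4}
    (hz : z ∈ (extChartAt (𝓡 4) p).target) :
    fderiv ℝ (F ∘ (extChartAt (𝓡 4) p).symm) z =
      (mfderiv (𝓡 4) (𝓡 5) F ((extChartAt (𝓡 4) p).symm z)).comp
        (mfderiv 𝓘(ℝ, 𝔼 4) (𝓡 4) (extChartAt (𝓡 4) p).symm z) := by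
  have h1 : MDifferentiableAt 𝓘(ℝ, 𝔼 4) (𝓡 4) (extChartAt (𝓡 4) p).symm z := by
    have h := mdifferentiableWithinAt_extChartAt_symm hz
    rw [ModelWithCorners.Boundaryless.range_eq_univ] at h
    exact h.mdifferentiableAt univ_mem
  have h2 : MDifferentiableAt (𝓡 4) (𝓡 5) F ((extChartAt (𝓡 4) p).symm z) :=
    hF.mdifferentiableAt (by simp)
  rw [← mfderiv_eq_fderiv]
  exact mfderiv_comp z h2 h1

/-- In the chart, the oriented normal is normal to the image of `D(F ∘ φ⁻¹)`. [folklore] -/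
theorem inner_orientedNormal_fderiv_chart (o : SmoothOrientation (𝓡 4) M)
    (hF : ContMDiff (𝓡 4) (𝓡 5) ∞ F) (p : M) {z : 𝔼 4} (hz : z ∈ (extChartAt (𝓡 4) p).target)
    (w : 𝔼 4) :
    ⟪(orientedNormal o F ∘ (extChartAt (𝓡 4) p).symm) z,
      fderiv ℝ (F ∘ (extChartAt (𝓡 4) p).symm) z w⟫_ℝ = 0 := by
  haveI : IsManifold (𝓡 4) 1 M :=
    IsManifold.of_le (n := ∞) (by exact_mod_cast (le_top : (1 : ℕ∞) ≤ ⊤))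
  rw [fderiv_comp_extChartAt_symm hF p hz]
  exact inner_orientedNormal_mfderiv o F _ _

/-- The chart expression of `F` is `C^∞` at the centre of the chart. [folklore] -/
theorem contDiffAt_comp_extChartAt_symm (hF : ContMDiff (𝓡 4) (𝓡 5) ∞ F) (p : M) :
    ContDiffAt ℝ ∞ (F ∘ (extChartAt (𝓡 4) p).symm) (extChartAt (𝓡 4) p p) :=
  (contDiffOn_comp_extChartAt_symm hF p).contDiffAt (extChartAt_target_mem_nhds p)

/-- The oriented normal of a `C^∞` immersion is `C¹` (in fact `C^∞`), as a map to `ℝ⁵`.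
[folklore] -/
theorem contMDiff_orientedNormal_one (o : SmoothOrientation (𝓡 4) M)
    (hF : ContMDiff (𝓡 4) (𝓡 5) ∞ F) (hinj : ∀ x, Injective (mfderiv (𝓡 4) (𝓡 5) F x)) :
    ContMDiff (𝓡 4) 𝓘(ℝ, 𝔼 5) 1 (orientedNormal o F) := fun x =>
  contMDiffAt_orientedNormal o (k := 1) (hF.of_le (natCast_le_infty (1 + 1))) hinj x

/-- The chart expression of the oriented normal is differentiable at the centre. [folklore] -/
theorem differentiableAt_orientedNormal_chart (o : SmoothOrientation (𝓡 4) M)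
    (hF : ContMDiff (𝓡 4) (𝓡 5) ∞ F) (hinj : ∀ x, Injective (mfderiv (𝓡 4) (𝓡 5) F x)) (p : M) :
    DifferentiableAt ℝ (orientedNormal o F ∘ (extChartAt (𝓡 4) p).symm) (extChartAt (𝓡 4) p p) := by
  have h : ContMDiffOn 𝓘(ℝ, 𝔼 4) 𝓘(ℝ, 𝔼 5) 1 (orientedNormal o F ∘ (extChartAt (𝓡 4) p).symm)
      (extChartAt (𝓡 4) p).target :=
    (contMDiff_orientedNormal_one o hF hinj).comp_contMDiffOn (contMDiffOn_extChartAt_symm p)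
  have h' := (contMDiffOn_iff_contDiffOn.1 h).contDiffAt (extChartAt_target_mem_nhds p)
  exact h'.differentiableAt one_ne_zero

/-- The differential of the chart expression of an immersion at the centre is injective
(`injective_fderiv_comp_extChartAt_symm`). [folklore] -/
theorem injective_fderiv_chart (hF : ContMDiff (𝓡 4) (𝓡 5) ∞ F)
    (hinj : ∀ x, Injective (mfderiv (𝓡 4) (𝓡 5) F x)) (p : M) :
    Injective (fderiv ℝ (F ∘ (extChartAt (𝓡 4) p).symm) (extChartAt (𝓡 4) p p)) :=
  injective_fderiv_comp_extChartAt_symm hF hinj p (mem_extChartAt_target p)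

/-- The differential of the oriented normal takes values in the tangent hyperplane
`D(F ∘ φ⁻¹)(ℝ⁴) = ν^⊥` (differentiate `‖ν‖ = 1`). [folklore] -/
theorem fderiv_orientedNormal_mem_range (o : SmoothOrientation (𝓡 4) M)
    (hF : ContMDiff (𝓡 4) (𝓡 5) ∞ F) (hinj : ∀ x, Injective (mfderiv (𝓡 4) (𝓡 5) F x)) (p : M)
    (v : 𝔼 4) :
    fderiv ℝ (orientedNormal o F ∘ (extChartAt (𝓡 4) p).symm) (extChartAt (𝓡 4) p p) v ∈
      LinearMap.range (fderiv ℝ (F ∘ (extChartAt (𝓡 4) p).symm) (extChartAt (𝓡 4) p p)).toLinearMap := by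
  have hn0 : (orientedNormal o F ∘ (extChartAt (𝓡 4) p).symm) (extChartAt (𝓡 4) p p) ≠ 0 := by
    rw [Function.comp_apply, extChartAt_to_inv]
    exact orientedNormal_ne_zero o (hinj p)
  rw [range_eq_orthogonal_of_inner_eq_zero (injective_fderiv_chart hF hinj p) hn0
    (inner_orientedNormal_fderiv_chart o hF p (mem_extChartAt_target p)),
    Submodule.mem_orthogonal_singleton_iff_inner_right]
  refine inner_fderiv_self_eq_zero (differentiableAt_orientedNormal_chart o hF hinj p) ?_ v
  filter_upwards [extChartAt_target_mem_nhds (I := 𝓡 4) p] with y hy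
  exact norm_orientedNormal o (hinj _)

/-- **The shape operator of an immersed oriented hypersurface at `p`, in the preferred chart**:
the endomorphism `L` of `ℝ⁴` with `D(F ∘ φ⁻¹) ∘ L = D(ν ∘ φ⁻¹)` at `φ p`. [folklore] -/
def chartShapeOp (o : SmoothOrientation (𝓡 4) M) (hF : ContMDiff (𝓡 4) (𝓡 5) ∞ F)
    (hinj : ∀ x, Injective (mfderiv (𝓡 4) (𝓡 5) F x)) (p : M) : (𝔼 4) →ₗ[ℝ] 𝔼 4 :=
  shapeOp (fderiv ℝ (F ∘ (extChartAt (𝓡 4) p).symm) (extChartAt (𝓡 4) p p))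
    (fderiv ℝ (orientedNormal o F ∘ (extChartAt (𝓡 4) p).symm) (extChartAt (𝓡 4) p p))
    (injective_fderiv_chart hF hinj p) (fderiv_orientedNormal_mem_range o hF hinj p)

/-- **Index of a height function versus the shape operator** (Guillemin–Pollack 1974, Ch. 4 §9,
p. 197; Milnor 1963, §6).  Let `F : M⁴ → ℝ⁵` be a `C^∞` immersion of an oriented manifold with
oriented unit normal `ν`, `a = σ ν(p)` (`σ = ±1`), and suppose the Hessian of the height function
`h_a = ⟪a, F⟫` at `p` is nondegenerate.  Then the shape operator `L` at `p` (in the preferred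
chart) has `det L ≠ 0` and `sign det L = (−1)^{index_p h_a}`. [cite: GuilleminPollack1974, Ch. 4 §9 p. 197] -/
theorem det_chartShapeOp_sign (o : SmoothOrientation (𝓡 4) M) (hF : ContMDiff (𝓡 4) (𝓡 5) ∞ F)
    (hinj : ∀ x, Injective (mfderiv (𝓡 4) (𝓡 5) F x)) {a : 𝔼 5} {p : M} {σ : ℝ}
    (hσ : σ = 1 ∨ σ = -1) (hap : a = σ • orientedNormal o F p)
    (hnd : (mhessian (𝓡 4) (fun m => ⟪a, F m⟫_ℝ) p).Nondegenerate) :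
    LinearMap.det (chartShapeOp o hF hinj p) ≠ 0 ∧
      LinearMap.det (chartShapeOp o hF hinj p) / |LinearMap.det (chartShapeOp o hF hinj p)| =
        (-1 : ℝ) ^ morseIndex (𝓡 4) (fun m => ⟪a, F m⟫_ℝ) p := by
  set φ := extChartAt (𝓡 4) p with hφ
  set g : (𝔼 4) → 𝔼 5 := F ∘ φ.symm with hg
  set N : (𝔼 4) → 𝔼 5 := orientedNormal o F ∘ φ.symm with hN
  have hs : φ.target ∈ 𝓝 (φ p) := extChartAt_target_mem_nhds p
  have hgs : ContDiffOn ℝ ∞ g φ.target := contDiffOn_comp_extChartAt_symm hF p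
  have hgc : ContDiffAt ℝ ∞ g (φ p) := hgs.contDiffAt hs
  have hgd : DifferentiableOn ℝ g φ.target := hgs.differentiableOn (by simp)
  have hg2 : DifferentiableAt ℝ (fderiv ℝ g) (φ p) :=
    (hgc.fderiv_right (m := 1) (natCast_le_infty (1 + 1))).differentiableAt one_ne_zero
  have hNc : N (φ p) = orientedNormal o F p := by
    rw [hN, Function.comp_apply, extChartAt_to_inv]
  -- the height function in the chart
  have hha : ContDiffAt ℝ ∞ (fun y => ⟪a, g y⟫_ℝ) (φ p) := contDiffAt_const.inner ℝ hgc
  have hB : ∀ v w, mhessian (𝓡 4) (fun m => ⟪a, F m⟫_ℝ) p v w =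
      fderiv ℝ (fderiv ℝ fun y => ⟪σ • N (φ p), g y⟫_ℝ) (φ p) v w := by
    intro v w
    rw [hNc, ← hap, ← hessianInChart_chartAt, hessianInChart_apply_apply,
      ModelWithCorners.Boundaryless.range_eq_univ, fderivWithin_univ]
    have : fderivWithin ℝ ((fun m => ⟪a, F m⟫_ℝ) ∘ ((chartAt (𝔼 4) p).extend (𝓡 4)).symm) univ =
        fderiv ℝ fun y => ⟪a, g y⟫_ℝ := by
      ext1 y
      rw [fderivWithin_univ]
      rfl
    rw [this]
    rfl
  have hBs : (mhessian (𝓡 4) (fun m => ⟪a, F m⟫_ℝ) p).IsSymm := by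
    refine ⟨fun v w => ?_⟩
    rw [hB, hB, hNc, ← hap]
    exact hha.isSymmSndFDerivAt (by simpa using natCast_le_infty 2) v w
  have h := det_shapeOp_sign (g := g) (ν := N) hs hgd hg2 (injective_fderiv_chart hF hinj p)
    (differentiableAt_orientedNormal_chart o hF hinj p)
    (fun y hy w => inner_orientedNormal_fderiv_chart o hF p hy w)
    (fderiv_orientedNormal_mem_range o hF hinj p) hσ hB hBs hnd
  exact h

end Wrap

/-! ### The local degree sign of the Gauss map versus the shape operator -/

section Delta

variable {M : Type*} [TopologicalSpace M] [ChartedSpace (𝔼 4) M] [IsManifold (𝓡 4) ∞ M]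
  {F : M → 𝔼 5}


/-- `ℝ⁵` has dimension `4 + 1` (the `Fact` feeding Mathlib's manifold structure on `S⁴`).
[folklore] -/
instance instFactFinrankFive' : Fact (Module.finrank ℝ (𝔼 5) = 4 + 1) := ⟨by simp⟩

omit [IsManifold (𝓡 4) ∞ M] in
/-- `mfderiv` of a map into `ℝ⁵` is the derivative of its chart expression (boundaryless
source). [folklore] -/
theorem mfderiv_eq_fderiv_comp_extChartAt_symm {f : M → 𝔼 5} {p : M}
    (hf : MDifferentiableAt (𝓡 4) (𝓡 5) f p) :
    mfderiv (𝓡 4) (𝓡 5) f p = fderiv ℝ (f ∘ (extChartAt (𝓡 4) p).symm) (extChartAt (𝓡 4) p p) := by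
  rw [hf.mfderiv, ModelWithCorners.Boundaryless.range_eq_univ, fderivWithin_univ]
  rfl

/-- The Gauss map `M → S⁴` of a `C^∞` immersion (the oriented normal, restricted to the sphere)
is `C¹`. [folklore] -/
theorem contMDiff_gaussSph (o : SmoothOrientation (𝓡 4) M) (hF : ContMDiff (𝓡 4) (𝓡 5) ∞ F)
    (hinj : ∀ x, Injective (mfderiv (𝓡 4) (𝓡 5) F x)) :
    ContMDiff (𝓡 4) (𝓡 4) 1 (fun x => (⟨orientedNormal o F x,
      mem_sphere_zero_iff_norm.2 (norm_orientedNormal o (hinj x))⟩ : 𝕊⁴)) :=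
  (contMDiff_orientedNormal_one o hF hinj).codRestrict_sphere (n := 4) _

/-- **The sign of the shape operator is the orientation behaviour of the Gauss map.**  Let
`nuS : M → S⁴` be the Gauss map of the `C^∞` immersion `F` of the oriented `4`-manifold `(M, o)`,
`S⁴` oriented by `oS` with outward oriented normal, `p ∈ M`, `y = nuS p`, `A = dnuS_p` read in the
preferred charts and `L` the shape operator in the chart at `p`.  Then `det L ≠ 0 → det A ≠ 0` and
`sign det L = 1 ↔ (oS y = o p ↔ 0 < det A)` — i.e. `sign det L = +1` exactly when `nuS` preserves
the orientations at `p` (Guillemin–Pollack 1974, Ch. 4 §9, p. 196: the degree of the Gauss map is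
computed with `T_pM` and `T_{ν(p)}S⁴` identified as the same oriented hyperplane). [cite: GuilleminPollack1974, Ch. 4 §9 p. 196] -/
theorem sign_det_chartShapeOp_iff (o : SmoothOrientation (𝓡 4) M) (hF : ContMDiff (𝓡 4) (𝓡 5) ∞ F)
    (hinj : ∀ x, Injective (mfderiv (𝓡 4) (𝓡 5) F x)) (oS : SmoothOrientation (𝓡 4) 𝕊⁴)
    (hoS : ∀ y : 𝕊⁴, orientedNormal oS (Subtype.val : 𝕊⁴ → 𝔼 5) y = (y : 𝔼 5)) (p : M)
    (hdet : LinearMap.det (chartShapeOp o hF hinj p) ≠ 0) :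
    let nuS : M → 𝕊⁴ := fun x => ⟨orientedNormal o F x,
      mem_sphere_zero_iff_norm.2 (norm_orientedNormal o (hinj x))⟩
    LinearMap.det (M := 𝔼 4) (mfderiv (𝓡 4) (𝓡 4) nuS p).toLinearMap ≠ 0 ∧
      (LinearMap.det (chartShapeOp o hF hinj p) / |LinearMap.det (chartShapeOp o hF hinj p)| = 1 ↔
        (oS (nuS p) = o p ↔
          0 < LinearMap.det (M := 𝔼 4) (mfderiv (𝓡 4) (𝓡 4) nuS p).toLinearMap)) := by
  intro nuS
  haveI : IsManifold (𝓡 4) 1 M :=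
    IsManifold.of_le (n := ∞) (by exact_mod_cast (le_top : (1 : ℕ∞) ≤ ⊤))
  set φ := extChartAt (𝓡 4) p with hφ
  set y : 𝕊⁴ := nuS p with hy
  -- the three differentials
  set Dg : (𝔼 4) →L[ℝ] 𝔼 5 := fderiv ℝ (F ∘ φ.symm) (φ p) with hDg
  set J : (𝔼 4) →L[ℝ] 𝔼 5 := mfderiv (𝓡 4) (𝓡 5) (Subtype.val : 𝕊⁴ → 𝔼 5) y with hJ
  set A : (𝔼 4) →L[ℝ] 𝔼 4 := mfderiv (𝓡 4) (𝓡 4) nuS p with hA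
  have hnuS : ContMDiff (𝓡 4) (𝓡 4) 1 nuS := contMDiff_gaussSph o hF hinj
  have hval : ContMDiff (𝓡 4) (𝓡 5) ∞ (Subtype.val : 𝕊⁴ → 𝔼 5) := contMDiff_coe_sphere
  -- `Dg = dF_p` (preferred chart)
  have hDgm : mfderiv (𝓡 4) (𝓡 5) F p = Dg :=
    mfderiv_eq_fderiv_comp_extChartAt_symm (hF.mdifferentiableAt (by simp))
  -- `Dν̂ = J ∘ A`
  have hchain : fderiv ℝ (orientedNormal o F ∘ φ.symm) (φ p) = J.comp A := by
    have h1 : orientedNormal o F = (Subtype.val : 𝕊⁴ → 𝔼 5) ∘ nuS := rfl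
    have hmd : MDifferentiableAt (𝓡 4) (𝓡 5) (orientedNormal o F) p :=
      ((contMDiff_orientedNormal_one o hF hinj) p).mdifferentiableAt one_ne_zero
    rw [← mfderiv_eq_fderiv_comp_extChartAt_symm hmd, h1]
    exact mfderiv_comp p ((hval y).mdifferentiableAt (by simp)) ((hnuS p).mdifferentiableAt one_ne_zero)
  -- `J` takes values in `y^⊥ = range Dg`
  have hn0 : (orientedNormal o F ∘ φ.symm) (φ p) ≠ 0 := by
    rw [Function.comp_apply, extChartAt_to_inv]
    exact orientedNormal_ne_zero o (hinj p)
  have hyn : (y : 𝔼 5) = orientedNormal o F p := rfl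
  have hrange : LinearMap.range Dg.toLinearMap = (ℝ ∙ (y : 𝔼 5))ᗮ := by
    rw [range_eq_orthogonal_of_inner_eq_zero (injective_fderiv_chart hF hinj p) hn0
      (inner_orientedNormal_fderiv_chart o hF p (mem_extChartAt_target p))]
    congr 2
    rw [Function.comp_apply, extChartAt_to_inv]
  have hJmem : ∀ v, J v ∈ LinearMap.range Dg.toLinearMap := fun v => by
    rw [hrange, ← range_mfderiv_coe_sphere (n := 4) y]
    exact ⟨v, rfl⟩
  -- the comparison `T = Dg⁻¹ ∘ J` and `L = T ∘ A`
  set T := shapeOp Dg J (injective_fderiv_chart hF hinj p) hJmem with hT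
  have hTapply : ∀ v, Dg (T v) = J v := apply_shapeOp Dg J _ hJmem
  have hL : chartShapeOp o hF hinj p = T ∘ₗ A.toLinearMap := by
    apply LinearMap.ext
    intro v
    apply injective_fderiv_chart hF hinj p
    show Dg (chartShapeOp o hF hinj p v) = Dg (T (A v))
    rw [hTapply, chartShapeOp, apply_shapeOp, hchain]
    rfl
  have hdetL : LinearMap.det (chartShapeOp o hF hinj p) =
      LinearMap.det T * LinearMap.det (M := 𝔼 4) A.toLinearMap := by
    rw [hL, LinearMap.det_comp]
  have hT0 : LinearMap.det T ≠ 0 := fun h => hdet (by rw [hdetL, h, zero_mul])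
  have hA0 : LinearMap.det (M := 𝔼 4) A.toLinearMap ≠ 0 := fun h => hdet (by rw [hdetL, h, mul_zero])
  refine ⟨hA0, ?_⟩
  -- cross products: `vecCross (J e) = det T • vecCross (Dg e)`
  have hcross : vecCross (fun i => J (EuclideanSpace.single i (1 : ℝ))) =
      LinearMap.det T • vecCross (fun i => Dg (EuclideanSpace.single i (1 : ℝ))) := by
    have h := vecCross_comp_eq_det_smul Dg (LinearMap.toContinuousLinearMap T)
    simp only [LinearMap.coe_toContinuousLinearMap', hTapply] at h
    rw [h]
    congr 1
  -- `⟪vecCross (Dg e), y⟫ = s_o ‖…‖`, `⟪vecCross (J e), y⟫ = s_S ‖…‖`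
  have hC : crossNormal F p = vecCross (fun i => Dg (EuclideanSpace.single i (1 : ℝ))) := by
    rw [crossNormal]
    simp only [mfderivE, hDgm]
  have hCS : crossNormal (Subtype.val : 𝕊⁴ → 𝔼 5) y =
      vecCross (fun i => J (EuclideanSpace.single i (1 : ℝ))) := rfl
  have hC0 : crossNormal F p ≠ 0 := crossNormal_ne_zero (hinj p)
  have hCS0 : crossNormal (Subtype.val : 𝕊⁴ → 𝔼 5) y ≠ 0 :=
    crossNormal_ne_zero (mfderiv_coe_sphere_injective (n := 4) y)
  have hin1 : ⟪crossNormal F p, (y : 𝔼 5)⟫_ℝ = orientationSignStd o p * ‖crossNormal F p‖ := by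
    rw [hyn, orientedNormal, inner_smul_right, real_inner_self_eq_norm_sq]
    field_simp
  have hin2 : ⟪crossNormal (Subtype.val : 𝕊⁴ → 𝔼 5) y, (y : 𝔼 5)⟫_ℝ =
      orientationSignStd oS y * ‖crossNormal (Subtype.val : 𝕊⁴ → 𝔼 5) y‖ := by
    conv_lhs => rw [← hoS y]
    rw [orientedNormal, inner_smul_right, real_inner_self_eq_norm_sq]
    field_simp
  have hrel : orientationSignStd oS y * ‖crossNormal (Subtype.val : 𝕊⁴ → 𝔼 5) y‖ =
      LinearMap.det T * (orientationSignStd o p * ‖crossNormal F p‖) := by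
    rw [← hin1, ← hin2, hCS, hcross, hC, inner_smul_left]
    simp
  -- signs
  have hso : orientationSignStd o p = 1 ∨ orientationSignStd o p = -1 := by
    unfold orientationSignStd; split_ifs <;> simp
  have hsS : orientationSignStd oS y = 1 ∨ orientationSignStd oS y = -1 := by
    unfold orientationSignStd; split_ifs <;> simp
  have hnC : 0 < ‖crossNormal F p‖ := norm_pos_iff.2 hC0
  have hnCS : 0 < ‖crossNormal (Subtype.val : 𝕊⁴ → 𝔼 5) y‖ := norm_pos_iff.2 hCS0
  -- `sign det T = s_o s_S`
  have hsignT : 0 < orientationSignStd o p * orientationSignStd oS y * LinearMap.det T := by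
    have h2 : orientationSignStd oS y * (orientationSignStd oS y *
        ‖crossNormal (Subtype.val : 𝕊⁴ → 𝔼 5) y‖) =
        orientationSignStd oS y * (LinearMap.det T * (orientationSignStd o p * ‖crossNormal F p‖)) := by
      rw [hrel]
    have hss : orientationSignStd oS y * orientationSignStd oS y = 1 := by
      rcases hsS with h | h <;> rw [h] <;> norm_num
    have h3 : ‖crossNormal (Subtype.val : 𝕊⁴ → 𝔼 5) y‖ =
        (orientationSignStd o p * orientationSignStd oS y * LinearMap.det T) * ‖crossNormal F p‖ := by
      calc ‖crossNormal (Subtype.val : 𝕊⁴ → 𝔼 5) y‖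
          = (orientationSignStd oS y * orientationSignStd oS y) *
              ‖crossNormal (Subtype.val : 𝕊⁴ → 𝔼 5) y‖ := by rw [hss, one_mul]
        _ = orientationSignStd oS y * (LinearMap.det T * (orientationSignStd o p * ‖crossNormal F p‖)) := by
              rw [mul_assoc, h2]
        _ = _ := by ring
    by_contra hle
    push Not at hle
    have : ‖crossNormal (Subtype.val : 𝕊⁴ → 𝔼 5) y‖ ≤ 0 := by
      rw [h3]
      exact mul_nonpos_of_nonpos_of_nonneg hle hnC.le
    linarith
  -- orientation values versus signs
  have hcard : Fintype.card (Fin (Module.finrank ℝ (𝔼 4))) = Module.finrank ℝ (𝔼 4) :=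
    Fintype.card_fin _
  have hoiff : (oS y = o p) ↔ orientationSignStd oS y = orientationSignStd o p := by
    have hS := Orientation.eq_or_eq_neg (oS y) (stdOrientationModel 4) hcard
    have hO := Orientation.eq_or_eq_neg (o p) (stdOrientationModel 4) hcard
    have hne : stdOrientationModel 4 ≠ -stdOrientationModel 4 := Module.Ray.ne_neg_self _
    unfold orientationSignStd
    rcases hS with hS | hS <;> rcases hO with hO | hO <;> simp [hS, hO, hne, hne.symm] <;> norm_num
  -- conclude by sign bookkeeping
  rw [hdetL]
  have key : ∀ (so sS t a : ℝ), (so = 1 ∨ so = -1) → (sS = 1 ∨ sS = -1) → 0 < so * sS * t → a ≠ 0 →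
      (t * a / |t * a| = 1 ↔ (sS = so ↔ 0 < a)) := by
    intro so sS t a hso hsS ht ha
    have ht0 : t ≠ 0 := by rintro rfl; simp at ht
    rcases hso with rfl | rfl <;> rcases hsS with rfl | rfl
    · have ht' : 0 < t := by linarith
      rcases lt_or_gt_of_ne ha with ha' | ha'
      · rw [abs_of_neg (mul_neg_of_pos_of_neg ht' ha')]
        constructor
        · intro h; field_simp at h; linarith [mul_neg_of_pos_of_neg ht' ha']
        · intro h; exact absurd (h.1 rfl) (not_lt.2 ha'.le)
      · rw [abs_of_pos (mul_pos ht' ha'), div_self (mul_ne_zero ht0 ha)]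
        simp [ha']
    · have ht' : t < 0 := by linarith
      rcases lt_or_gt_of_ne ha with ha' | ha'
      · rw [abs_of_pos (mul_pos_of_neg_of_neg ht' ha'), div_self (mul_ne_zero ht0 ha)]
        simp only [true_iff]
        constructor
        · intro h; norm_num at h
        · intro h; exact absurd h (not_lt.2 ha'.le)
      · rw [abs_of_neg (mul_neg_of_neg_of_pos ht' ha')]
        constructor
        · intro h; field_simp at h; linarith [mul_neg_of_neg_of_pos ht' ha']
        · intro h; have := h.2 ha'; norm_num at this
    · have ht' : t < 0 := by linarith
      rcases lt_or_gt_of_ne ha with ha' | ha'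
      · rw [abs_of_pos (mul_pos_of_neg_of_neg ht' ha'), div_self (mul_ne_zero ht0 ha)]
        simp only [true_iff]
        constructor
        · intro h; norm_num at h
        · intro h; exact absurd h (not_lt.2 ha'.le)
      · rw [abs_of_neg (mul_neg_of_neg_of_pos ht' ha')]
        constructor
        · intro h; field_simp at h; linarith [mul_neg_of_neg_of_pos ht' ha']
        · intro h; have := h.2 ha'; norm_num at this
    · have ht' : 0 < t := by linarith
      rcases lt_or_gt_of_ne ha with ha' | ha'
      · rw [abs_of_neg (mul_neg_of_pos_of_neg ht' ha')]
        constructor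
        · intro h; field_simp at h; linarith [mul_neg_of_pos_of_neg ht' ha']
        · intro h; exact absurd (h.1 rfl) (not_lt.2 ha'.le)
      · rw [abs_of_pos (mul_pos ht' ha'), div_self (mul_ne_zero ht0 ha)]
        simp [ha']
  rw [hoiff]
  exact key _ _ _ _ hso hsS hsignT hA0

end Delta

/-! ### The local degree of the Gauss map at a point with nondegenerate shape operator -/

section LocalDegreeGauss

open CategoryTheory TopologicalSpace Literature.AlgebraicTopology.SingularHomology
open Literature.Geometry.Manifold

variable {M : Type} [TopologicalSpace M] [T2Space M] [ChartedSpace (𝔼 4) M]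
  [IsManifold (𝓡 4) ∞ M] {F : M → 𝔼 5}


omit [T2Space M] in
/-- **The Gauss map is injective near a point with nondegenerate shape operator** (inverse
function theorem: `dν̄_p` is invertible, `sign_det_chartShapeOp_iff`). [folklore] -/
theorem exists_opens_injective_gauss (o : SmoothOrientation (𝓡 4) M)
    (hF : ContMDiff (𝓡 4) (𝓡 5) ∞ F) (hinj : ∀ x, Injective (mfderiv (𝓡 4) (𝓡 5) F x))
    (oS : SmoothOrientation (𝓡 4) 𝕊⁴)
    (hoS : ∀ y : 𝕊⁴, orientedNormal oS (Subtype.val : 𝕊⁴ → 𝔼 5) y = (y : 𝔼 5)) (p : M)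
    (hdet : LinearMap.det (chartShapeOp o hF hinj p) ≠ 0) :
    let nuS : M → 𝕊⁴ := fun x => ⟨orientedNormal o F x,
      mem_sphere_zero_iff_norm.2 (norm_orientedNormal o (hinj x))⟩
    ∃ U : Opens M, p ∈ U ∧ Function.Injective (nuS ∘ (Subtype.val : U → M)) := by
  intro nuS
  have hν : ContMDiff (𝓡 4) (𝓡 4) 1 nuS := contMDiff_gaussSph o hF hinj
  obtain ⟨hA0, -⟩ := sign_det_chartShapeOp_iff o hF hinj oS hoS p hdet
  set A : (𝔼 4) →L[ℝ] 𝔼 4 := mfderiv (𝓡 4) (𝓡 4) nuS p with hA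
  have hAinj : Function.Injective A.toLinearMap := by
    have hker : LinearMap.ker A.toLinearMap = ⊥ :=
      (LinearMap.isUnit_iff_ker_eq_bot _).1 ((LinearMap.isUnit_iff_isUnit_det _).2 (Ne.isUnit hA0))
    exact LinearMap.ker_eq_bot.1 hker
  have hAsurj : Surjective A.toLinearMap := LinearMap.injective_iff_surjective.1 hAinj
  let eA : (𝔼 4) ≃L[ℝ] 𝔼 4 :=
    (LinearEquiv.ofBijective A.toLinearMap ⟨hAinj, hAsurj⟩).toContinuousLinearEquiv
  have heA : mfderiv (𝓡 4) (𝓡 4) nuS p = (eA : (𝔼 4) →L[ℝ] 𝔼 4) := by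
    ext v
    rfl
  obtain ⟨Φ, hpΦ, hEq⟩ :=
    Literature.Geometry.Manifold.isLocalDiffeomorphAt_of_mfderiv one_ne_zero isOpen_univ (mem_univ p)
      hν.contMDiffOn eA heA
  refine ⟨⟨Φ.source, Φ.open_source⟩, hpΦ, ?_⟩
  intro x x' h
  apply Subtype.ext
  have h' : Φ x.1 = Φ x'.1 := by
    rw [← hEq x.2, ← hEq x'.2]
    exact h
  exact Φ.injOn x.2 x'.2 h'

/-- **The local degree of the Gauss map.**  Let `ν̄ : M → S⁴` be the Gauss map of a `C^∞`
immersion `F` of the oriented `4`-manifold `(M, o)` (`S⁴` oriented by `oS` with outward normal,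
homological orientations `μ`, `μS` compatible with `o`, `oS`), let `p` be a point where the
shape operator `L` (in the chart at `p`) is nondegenerate, and `V ∋ p` an open set on which `ν̄` is
injective.  Then `ν̄|_V` carries the local orientation class of `V` at `p` (which restricts that
of `M`, `map_val_restrictOpens_localClass`) to `sign det L` times the local orientation class of
`S⁴` at `ν̄ p` (Bredon 1993, VI.7 Thm. 7.15: a local diffeomorphism acts on local orientations by
the sign of its Jacobian; here the sign is that of `det L`, `sign_det_chartShapeOp_iff`).
[cite: GuilleminPollack1974, Ch. 4 §9 p. 196] -/
theorem localDegree_gauss (o : SmoothOrientation (𝓡 4) M) (hF : ContMDiff (𝓡 4) (𝓡 5) ∞ F)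
    (hinj : ∀ x, Injective (mfderiv (𝓡 4) (𝓡 5) F x)) (oS : SmoothOrientation (𝓡 4) 𝕊⁴)
    (hoS : ∀ y : 𝕊⁴, orientedNormal oS (Subtype.val : 𝕊⁴ → 𝔼 5) y = (y : 𝔼 5))
    (g : HomologicalOrientation ℤ (𝔼 4) 4) (μ : HomologicalOrientation ℤ M 4)
    (μS : HomologicalOrientation ℤ 𝕊⁴ 4) (hμ : SmoothOrientation.IsCompatible g o μ)
    (hμS : SmoothOrientation.IsCompatible g oS μS) (p : M)
    (hdet : LinearMap.det (chartShapeOp o hF hinj p) ≠ 0) (V : Opens M) (hpV : p ∈ V)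
    (hinjV : Function.Injective ((fun x => (⟨orientedNormal o F x,
      mem_sphere_zero_iff_norm.2 (norm_orientedNormal o (hinj x))⟩ : 𝕊⁴)) ∘ (Subtype.val : V → M))) :
    let nuS : M → 𝕊⁴ := fun x => ⟨orientedNormal o F x,
      mem_sphere_zero_iff_norm.2 (norm_orientedNormal o (hinj x))⟩
    relativeSingularHomology.map ℤ ℤ
        ⟨nuS ∘ (Subtype.val : V → M), (contMDiff_gaussSph o hF hinj).continuous.comp
          continuous_subtype_val⟩
        (mapsTo_compl_singleton_of_injective hinjV rfl) 4
        ((μ.restrictOpens V).localClass ⟨p, hpV⟩) =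
      (if LinearMap.det (chartShapeOp o hF hinj p) / |LinearMap.det (chartShapeOp o hF hinj p)| = 1
        then (1 : ℤ) else -1) • μS.localClass (nuS p) := by
  intro nuS
  have hν : ContMDiff (𝓡 4) (𝓡 4) 1 nuS := contMDiff_gaussSph o hF hinj
  obtain ⟨hA0, hiff⟩ := sign_det_chartShapeOp_iff o hF hinj oS hoS p hdet
  set A : (𝔼 4) →L[ℝ] 𝔼 4 := mfderiv (𝓡 4) (𝓡 4) nuS p with hA
  -- the map `fU = ν̄ ∘ val : V → S⁴` and its differential at `x₀ = p`
  set x₀ : V := ⟨p, hpV⟩ with hx₀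
  set fU : V → 𝕊⁴ := nuS ∘ (Subtype.val : V → M) with hfU
  have hfUc : Continuous fU := hν.continuous.comp continuous_subtype_val
  have hfUs : ContMDiff (𝓡 4) (𝓡 4) 1 fU := hν.comp contMDiff_subtype_val
  have hdf : MDifferentiableAt (𝓡 4) (𝓡 4) fU x₀ := hfUs.mdifferentiableAt one_ne_zero
  have hmf : mfderiv (𝓡 4) (𝓡 4) fU x₀ = A := by
    have h1 : HasMFDerivAt (𝓡 4) (𝓡 4) nuS ((Subtype.val : V → M) x₀) A :=
      (hν.mdifferentiableAt one_ne_zero).hasMFDerivAt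
    have h2 := OpenSubmanifold.hasMFDerivAt_subtype_val (I := 𝓡 4) x₀
    rw [(h1.comp x₀ h2).mfderiv]
    ext v
    rfl
  have hdetU : LinearMap.det (M := 𝔼 4) (mfderiv (𝓡 4) (𝓡 4) fU x₀).toLinearMap ≠ 0 := by
    rw [hmf]; exact hA0
  have hoU : (o.restrict V) x₀ = o p := rfl
  have hμU : SmoothOrientation.IsCompatible g (o.restrict V) (μ.restrictOpens V) :=
    hμ.restrictOpens V
  -- two orientations only
  have hcard : Fintype.card (Fin (Module.finrank ℝ (𝔼 4))) = Module.finrank ℝ (𝔼 4) :=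
    Fintype.card_fin _
  by_cases hs : LinearMap.det (chartShapeOp o hF hinj p) /
      |LinearMap.det (chartShapeOp o hF hinj p)| = 1
  · -- orientation preserving at `p`
    rw [if_pos hs, one_smul]
    have hop : oS (fU x₀) = (o.restrict V) x₀ ↔
        0 < LinearMap.det (M := 𝔼 4) (mfderiv (𝓡 4) (𝓡 4) fU x₀).toLinearMap := by
      rw [hmf, hoU]
      exact hiff.1 hs
    exact SmoothOrientation.map_localClass_eq_of_isCompatibleAt g hfUc hinjV hdf hdetU hop (hμU x₀)
      (hμS (fU x₀))
  · -- orientation reversing at `p`: reverse the orientation of `V`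
    rw [if_neg hs]
    have hop' : oS (fU x₀) = (-(o.restrict V)) x₀ ↔
        0 < LinearMap.det (M := 𝔼 4) (mfderiv (𝓡 4) (𝓡 4) fU x₀).toLinearMap := by
      rw [hmf, SmoothOrientation.neg_apply, hoU]
      have h1 : ¬ (oS (nuS p) = o p ↔ 0 < LinearMap.det (M := 𝔼 4) A.toLinearMap) :=
        fun h => hs (hiff.2 h)
      have h2 : oS (nuS p) = -o p ↔ ¬ oS (nuS p) = o p :=
        (Orientation.ne_iff_eq_neg (oS (nuS p)) (o p) hcard).symm
      show oS (nuS p) = -o p ↔ 0 < LinearMap.det (M := 𝔼 4) A.toLinearMap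
      constructor
      · intro h
        by_contra hA'
        exact h1 ⟨fun h' => absurd h' (h2.1 h), fun h' => absurd h' hA'⟩
      · intro hA'
        exact h2.2 fun h' => h1 ⟨fun _ => hA', fun _ => h'⟩
    have key := SmoothOrientation.map_localClass_eq_of_isCompatibleAt g hfUc hinjV hdf hdetU hop'
      ((hμU.neg) x₀) (hμS (fU x₀))
    rw [HomologicalOrientation.neg_localClass, map_neg, neg_eq_iff_eq_neg] at key
    exact key.trans (neg_one_zsmul _).symm

end LocalDegreeGauss

/-! ### The degree as a sum of local degrees (Hatcher Prop. 2.30) -/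

section DegreeSum

open CategoryTheory TopologicalSpace Literature.AlgebraicTopology.SingularHomology
  Literature.AlgebraicTopology.Homotopy

variable {X Y : Type} [TopologicalSpace X] [T2Space X] [ChartedSpace (𝔼 4) X]
  [TopologicalSpace Y] [T2Space Y] [ChartedSpace (𝔼 4) Y]

omit [T2Space X] [ChartedSpace (𝔼 4) X] [T2Space Y] [ChartedSpace (𝔼 4) Y] in
/-- Near a point of a finite fibre separated from the other fibre points, the map sends the
punctured neighbourhood into the punctured target. [folklore] -/
theorem mapsTo_punctured_of_fibre {f : C(X, Y)} {y : Y} {ι : Type*} {v : ι → X}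
    (hfib : ∀ x, f x = y → x ∈ Set.range v) {U : ι → Opens X} (hvU : ∀ i, v i ∈ U i)
    (hsep : ∀ i l, l ≠ i → v l ∉ U i) (i : ι) :
    MapsTo (f ∘ (Subtype.val : U i → X)) ({(⟨v i, hvU i⟩ : U i)}ᶜ : Set (U i)) ({y}ᶜ : Set Y) := by
  intro x hx hfx
  obtain ⟨l, hl⟩ := hfib x.1 hfx
  by_cases hli : l = i
  · subst hli
    exact hx (Subtype.ext hl.symm)
  · exact hsep i l hli (hl ▸ x.2)

omit [T2Space X] [ChartedSpace (𝔼 4) X] [T2Space Y] [ChartedSpace (𝔼 4) Y] in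
/-- Transport of a local-degree identity along an equality of target points. [folklore] -/
theorem map_eq_zsmul_localClass_congr {V : Type} [TopologicalSpace V] {f₁ f₂ : C(V, Y)}
    (hf : f₁ = f₂) {x : V} {y₁ y₂ : Y} (h : y₁ = y₂) (h₁ : MapsTo f₁ ({x}ᶜ : Set V) ({y₁}ᶜ : Set Y))
    (h₂ : MapsTo f₂ ({x}ᶜ : Set V) ({y₂}ᶜ : Set Y)) (w : localHomology ℤ ℤ V x 4) (c : ℤ)
    (ν : HomologicalOrientation ℤ Y 4)
    (hw : relativeSingularHomology.map ℤ ℤ f₁ h₁ 4 w = c • ν.localClass y₁) :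
    relativeSingularHomology.map ℤ ℤ f₂ h₂ 4 w = c • ν.localClass y₂ := by
  subst hf h
  exact hw

/-- **The degree is the sum of the local degrees over a finite fibre** (Hatcher 2002,
Prop. 2.30; Milnor 1965, §6 Lemma 4 for the signs).  Let `f : X → Y` have degree `d` between closed
oriented `4`-manifolds, `y ∈ Y` with finite fibre `f⁻¹(y) = {v i}` (pairwise distinct), `U i ∋ v i`
open sets with `v l ∉ U i` for `l ≠ i`, and suppose `f|_{U i}` carries the local orientation class
of `U i` at `v i` to `ε i` times that of `Y` at `y`.  Then `d = Σ ε i`.  Proof: localise the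
fundamental class along the fibre (`eq_sum_of_forall_map_eq_restrictLocal`) and push forward to
`H₄(Y | y)`, where `[X] ↦ d • (μ_Y)_y`. [cite: HatcherAT2002, Prop. 2.30] -/
theorem HasDegree.eq_sum_of_localDegree [CompactSpace X] [ConnectedSpace Y] [CompactSpace Y]
    (μ : HomologicalOrientation ℤ X 4) (ν : HomologicalOrientation ℤ Y 4) {f : C(X, Y)} {d : ℤ}
    (hd : HasDegree μ ν f d) (y : Y) {ι : Type} [Fintype ι] {v : ι → X} (hv : Injective v)
    (hfib : ∀ x, f x = y ↔ x ∈ Set.range v) {U : ι → Opens X} (hvU : ∀ i, v i ∈ U i)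
    (hsep : ∀ i l, l ≠ i → v l ∉ U i) (ε : ι → ℤ)
    (hloc : ∀ i, relativeSingularHomology.map ℤ ℤ (f.comp (subsetIncl (U i : Set X)))
      (mapsTo_punctured_of_fibre (fun x hx => (hfib x).1 hx) hvU hsep i) 4
      ((μ.restrictOpens (U i)).localClass ⟨v i, hvU i⟩) = ε i • ν.localClass y) :
    d = ∑ i, ε i := by
  classical
  set S : Set X := Set.range v with hSdef
  have hS : S = ⋃ i ∈ (Finset.univ : Finset ι), ({v i} : Set X) := by
    ext x
    simp only [hSdef, Set.mem_range, Set.mem_iUnion, Set.mem_singleton_iff, Finset.mem_univ,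
      exists_true_left]
    exact ⟨fun ⟨i, hi⟩ => ⟨i, hi.symm⟩, fun ⟨i, hi⟩ => ⟨i, hi.symm⟩⟩
  have hfS : MapsTo f Sᶜ ({y}ᶜ : Set Y) := fun x hx hfx => hx ((hfib x).1 hfx)
  -- the fundamental class localised along the fibre
  set z : localHomologyOfSet ℤ ℤ X S 4 := singularHomology.toLocalOfSet ℤ ℤ X S 4 μ.fundamentalClass
    with hz
  have hzres : ∀ i, restrictLocal ℤ ℤ (localHomologyOfSet.singleton_subset_of_eq_biUnion_singleton hS i)
      4 z = μ.localClass (v i) := fun i => by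
    rw [hz, singularHomology.restrictLocal_toLocalOfSet, ← singularHomology.toLocal_eq_toLocalOfSet]
    exact HomologicalOrientation.isFundamentalClass_fundamentalClass_holds 4 μ (v i)
  -- the local pieces: the restricted orientations of the `U i`
  let w : ∀ i, relativeSingularHomology ℤ ℤ ↥(U i : Set X) {(⟨v i, hvU i⟩ : ↥(U i : Set X))}ᶜ 4 :=
    fun i => (μ.restrictOpens (U i)).localClass ⟨v i, hvU i⟩
  have hw : ∀ i, relativeSingularHomology.map ℤ ℤ (subsetIncl (U i : Set X))
      (localHomology.mapsTo_subsetIncl_compl (hvU i)) 4 (w i) =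
      restrictLocal ℤ ℤ (localHomologyOfSet.singleton_subset_of_eq_biUnion_singleton hS i) 4 z := by
    intro i
    rw [hzres]
    exact HomologicalOrientation.map_val_restrictOpens_localClass μ (U i) ⟨v i, hvU i⟩
  have hsum := localHomologyOfSet.eq_sum_of_forall_map_eq_restrictLocal ℤ ℤ hv hvU hsep hS 4 z w hw
  -- push forward along `f : (X, X ∖ S) → (Y, Y ∖ y)`
  have hpush : relativeSingularHomology.map ℤ ℤ f hfS 4 z = d • ν.localClass y := by
    rw [hz, singularHomology.toLocalOfSet, ← ModuleCat.comp_apply,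
      relativeSingularHomology.ofAbsolute_comp_map ℤ ℤ f hfS 4, ModuleCat.comp_apply, hd, map_zsmul]
    congr 1
    exact HomologicalOrientation.isFundamentalClass_fundamentalClass_holds 4 ν y
  have hterm : ∀ i, relativeSingularHomology.map ℤ ℤ f hfS 4
      (relativeSingularHomology.map ℤ ℤ (subsetIncl (U i : Set X))
        (localHomologyOfSet.mapsTo_subsetIncl_compl_of_forall_notMem hS hvU hsep i) 4 (w i)) =
      ε i • ν.localClass y := by
    intro i
    rw [← ModuleCat.comp_apply, ← relativeSingularHomology.map_comp]
    exact hloc i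
  have hsum' : relativeSingularHomology.map ℤ ℤ f hfS 4 z = ∑ i, ε i • ν.localClass y := by
    rw [hsum, map_sum]
    exact Finset.sum_congr rfl fun i _ => hterm i
  -- compare coefficients in `H₄(Y | y) ≅ ℤ`
  rw [hpush] at hsum'
  obtain ⟨e, he⟩ := ν.isGenerator y
  have h := congrArg e hsum'
  rw [map_zsmul, he, map_sum] at h
  simp only [map_zsmul, he, zsmul_eq_mul, mul_one] at h
  exact h

end DegreeSum

/-! ### Height functions: critical points are the fibres of the Gauss map over `±a` -/

section HeightCritical

variable {M : Type*} [TopologicalSpace M] [ChartedSpace (𝔼 4) M] [IsManifold (𝓡 4) ∞ M]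
  {F : M → 𝔼 5}

omit [IsManifold (𝓡 4) ∞ M] in
/-- The differential of a height function `y ↦ ⟪a, F y⟫` is `v ↦ ⟪a, dF v⟫`. [folklore] -/
theorem hasMFDerivAt_height (hF : ContMDiff (𝓡 4) (𝓡 5) ∞ F) (a : 𝔼 5) (p : M) :
    HasMFDerivAt (𝓡 4) 𝓘(ℝ, ℝ) (fun y => ⟪a, F y⟫_ℝ) p
      ((innerSL ℝ a).comp (mfderiv (𝓡 4) (𝓡 5) F p)) := by
  have h1 : HasMFDerivAt (𝓡 4) (𝓡 5) F p (mfderiv (𝓡 4) (𝓡 5) F p) :=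
    (hF.mdifferentiableAt (by simp)).hasMFDerivAt
  have h2 : HasMFDerivAt 𝓘(ℝ, 𝔼 5) 𝓘(ℝ, ℝ) (fun w : 𝔼 5 => ⟪a, w⟫_ℝ) (F p) (innerSL ℝ a) :=
    (innerSL ℝ a).hasFDerivAt.hasMFDerivAt
  exact h2.comp p h1

omit [IsManifold (𝓡 4) ∞ M] in
/-- **Critical points of a height function**: `p` is critical for `⟪a, F⟫` iff `a` is normal
to `dF_p(T_pM)` (Guillemin–Pollack 1974, Ch. 4 §9, p. 197). [folklore] -/
theorem isMCriticalPt_height_iff (hF : ContMDiff (𝓡 4) (𝓡 5) ∞ F) (a : 𝔼 5) (p : M) :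
    IsMCriticalPt (𝓡 4) (fun y => ⟪a, F y⟫_ℝ) p ↔ ∀ v, ⟪a, mfderiv (𝓡 4) (𝓡 5) F p v⟫_ℝ = 0 := by
  rw [IsMCriticalPt, (hasMFDerivAt_height hF a p).mfderiv]
  constructor
  · intro h v
    have := congrArg (fun φ : (𝔼 4) →L[ℝ] ℝ => φ v) h
    exact this
  · intro h
    ext v
    exact h v

/-- **Critical points of a height function are the fibres of the Gauss map over `±a`**: for a
unit vector `a`, `p` is critical for `⟪a, F⟫` iff `ν(p) = a` or `ν(p) = -a`
(Guillemin–Pollack 1974, Ch. 4 §9, p. 197). [cite: GuilleminPollack1974, Ch. 4 §9 p. 197] -/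
theorem isMCriticalPt_height_iff_orientedNormal (o : SmoothOrientation (𝓡 4) M)
    (hF : ContMDiff (𝓡 4) (𝓡 5) ∞ F) (hinj : ∀ x, Injective (mfderiv (𝓡 4) (𝓡 5) F x))
    {a : 𝔼 5} (ha : ‖a‖ = 1) (p : M) :
    IsMCriticalPt (𝓡 4) (fun y => ⟪a, F y⟫_ℝ) p ↔
      orientedNormal o F p = a ∨ orientedNormal o F p = -a := by
  haveI : IsManifold (𝓡 4) 1 M :=
    IsManifold.of_le (n := ∞) (by exact_mod_cast (le_top : (1 : ℕ∞) ≤ ⊤))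
  rw [isMCriticalPt_height_iff hF a p]
  constructor
  · intro h
    rcases eq_or_eq_neg_of_inner_eq_zero _ (hinj p) ha (norm_orientedNormal o (hinj p)) h
      (fun v => inner_orientedNormal_mfderiv o F p v) with h1 | h1
    · exact Or.inl h1
    · exact Or.inr h1
  · intro h v
    have h0 := inner_orientedNormal_mfderiv o F p v
    rcases h with h1 | h1
    · rwa [h1] at h0
    · rw [h1, inner_neg_left, neg_eq_zero] at h0
      exact h0

variable [CompactSpace M]

/-- **A Morse height function in a unit direction** (Guillemin–Pollack 1974, Ch. 1 §7 / Ch. 4 §9: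
almost every height function is Morse; `ae_isMorse_height`), normalised to `‖a‖ = 1` (a non-zero
multiple of a Morse function is Morse). [cite: GuilleminPollack1974, Ch. 4 §9 p. 198] -/
theorem exists_unit_isMorse_height (hF : ContMDiff (𝓡 4) (𝓡 5) ∞ F)
    (hinj : ∀ x, Injective (mfderiv (𝓡 4) (𝓡 5) F x)) :
    ∃ a : 𝔼 5, ‖a‖ = 1 ∧ IsMorse (𝓡 4) (fun y => ⟪a, F y⟫_ℝ) := by
  haveI : (MeasureTheory.ae (MeasureTheory.volume : MeasureTheory.Measure (𝔼 5))).NeBot :=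
    MeasureTheory.ae_neBot.2 (NeZero.ne MeasureTheory.volume)
  have h0 : ∀ᵐ a ∂(MeasureTheory.volume : MeasureTheory.Measure (𝔼 5)), a ≠ (0 : 𝔼 5) := by
    have : (MeasureTheory.volume : MeasureTheory.Measure (𝔼 5)) {0} = 0 :=
      MeasureTheory.measure_singleton 0
    filter_upwards [MeasureTheory.measure_eq_zero_iff_ae_notMem.1 this] with a ha
    exact ha
  obtain ⟨a, ha, ha0⟩ := ((ae_isMorse_height hF hinj).and h0).exists
  refine ⟨‖a‖⁻¹ • a, norm_smul_inv_norm ha0, ?_⟩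
  have h := ha.const_mul_add (inv_ne_zero (norm_ne_zero_iff.2 ha0)) 0
  have heq : (fun y => ‖a‖⁻¹ * ⟪a, F y⟫_ℝ + 0) = fun y => ⟪‖a‖⁻¹ • a, F y⟫_ℝ := by
    funext y
    rw [add_zero, real_inner_smul_left]
  rwa [heq] at h

end HeightCritical

/-! ### Hopf's curvatura integra theorem in dimension four: `χ(X) = 2 deg ν` -/

section CurvaturaIntegra

open CategoryTheory TopologicalSpace Literature.AlgebraicTopology.SingularHomology
  Literature.AlgebraicTopology.Homotopy


/-- `±1` read off from `(−1)^k`. [folklore] -/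
theorem ite_neg_one_pow_eq (k : ℕ) :
    (if ((-1 : ℝ) ^ k) = 1 then (1 : ℤ) else -1) = (-1 : ℤ) ^ k := by
  rcases Nat.even_or_odd k with hk | hk
  · rw [hk.neg_one_pow, hk.neg_one_pow, if_pos rfl]
  · rw [hk.neg_one_pow, hk.neg_one_pow, if_neg (by norm_num)]

/-- A compact set each of whose points has a neighbourhood meeting it only in that point is
finite. [folklore] -/
theorem Set.finite_of_forall_isolated {X : Type*} [TopologicalSpace X] {s : Set X}
    (hs : IsCompact s) (h : ∀ p ∈ s, ∃ U : Set X, IsOpen U ∧ p ∈ U ∧ ∀ q ∈ s, q ∈ U → q = p) :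
    s.Finite := by
  choose! U hUo hpU hU using h
  obtain ⟨t, hts, htfin, hcover⟩ := hs.elim_finite_subcover_image (b := s) (c := U)
    (fun p hp => hUo p hp) (fun p hp => Set.mem_biUnion hp (hpU p hp))
  refine htfin.subset fun q hq => ?_
  obtain ⟨p, hp, hqp⟩ := Set.mem_iUnion₂.1 (hcover hq)
  rw [hU p (hts hp) q hq hqp]
  exact hp

/-- **Hopf's curvatura integra theorem for hypersurfaces of `ℝ⁵`** (Hopf, Math. Ann. 96 (1927);
Guillemin–Pollack 1974, Ch. 4 §9, Theorem p. 198: "for even-dimensional [compact hypersurfaces]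
the Euler characteristic equals twice the degree of the Gauss map").  Let `X` be a closed
connected oriented `4`-manifold, `F : X → ℝ⁵` a `C^∞` immersion with Gauss map
`ν̄ : X → S⁴` (the oriented unit normal), `S⁴` oriented by its outward normal, the homological
orientations compatible.  If `ν̄` has degree `d` then `2 d = χ(X)`.

Proof (Guillemin–Pollack p. 198): choose a unit `a` with the height function `⟪a, F⟫` Morse
(`exists_unit_isMorse_height`); its critical points are `ν̄⁻¹(a) ∪ ν̄⁻¹(−a)`, and at each the sign
of the shape operator is `(−1)^{index}` (`det_chartShapeOp_sign`) and is the local degree of `ν̄`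
(`localDegree_gauss`); by the local degree formula (`HasDegree.eq_sum_of_localDegree`) at `a` and
at `−a`, `2d = Σ_{crit} (−1)^{index} = χ(X)` (`SphereMorseCount.morseCount_eq_relEuler`).
[cite: GuilleminPollack1974, Ch. 4 §9 p. 198] -/
theorem two_mul_degree_gauss_eq_relEuler {X : Type} [TopologicalSpace X] [T2Space X]
    [CompactSpace X] [ConnectedSpace X] [ChartedSpace (𝔼 4) X] [IsManifold (𝓡 4) ∞ X]
    {F : X → 𝔼 5} (hF : ContMDiff (𝓡 4) (𝓡 5) ∞ F)
    (hinj : ∀ x, Injective (mfderiv (𝓡 4) (𝓡 5) F x)) (o : SmoothOrientation (𝓡 4) X)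
    (oS : SmoothOrientation (𝓡 4) 𝕊⁴)
    (hoS : ∀ y : 𝕊⁴, orientedNormal oS (Subtype.val : 𝕊⁴ → 𝔼 5) y = (y : 𝔼 5))
    (g : HomologicalOrientation ℤ (𝔼 4) 4) (μ : HomologicalOrientation ℤ X 4)
    (μS : HomologicalOrientation ℤ 𝕊⁴ 4) (hμ : SmoothOrientation.IsCompatible g o μ)
    (hμS : SmoothOrientation.IsCompatible g oS μS) (nuC : C(X, 𝕊⁴))
    (hnuC : ∀ x, (nuC x : 𝔼 5) = orientedNormal o F x) {d : ℤ} (hd : HasDegree μ μS nuC d) :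
    2 * d = relEuler ℤ ℤ X ∅ := by
  classical
  haveI : SecondCountableTopology X := ChartedSpace.secondCountable_of_sigmaCompact (𝔼 4) X
  haveI : ConnectedSpace 𝕊⁴ := by
    refine isConnected_iff_connectedSpace.1 (isConnected_sphere ?_ (0 : 𝔼 5) zero_le_one)
    rw [← Module.finrank_eq_rank, finrank_euclideanSpace_fin]
    exact Nat.one_lt_cast.mpr (by norm_num)
  -- the Gauss map as the function `nuS`
  set nuS : X → 𝕊⁴ := fun x => ⟨orientedNormal o F x,
    mem_sphere_zero_iff_norm.2 (norm_orientedNormal o (hinj x))⟩ with hnuS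
  have hCeq : nuC = ⟨nuS, (contMDiff_gaussSph o hF hinj).continuous⟩ :=
    ContinuousMap.ext fun x => Subtype.ext (hnuC x)
  -- Step 1: a Morse height function
  obtain ⟨a, ha, hMorse⟩ := exists_unit_isMorse_height hF hinj
  set f : X → ℝ := fun y => ⟪a, F y⟫_ℝ with hfdef
  -- the two poles `±a ∈ S⁴`
  have hamem : ∀ s : ℝ, s = 1 ∨ s = -1 → s • a ∈ 𝕊⁴ := fun s hs => by
    rw [mem_sphere_zero_iff_norm, norm_smul, ha, mul_one, Real.norm_eq_abs]
    rcases hs with rfl | rfl <;> norm_num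
  -- Step 2: critical points versus fibres, nondegeneracy, signs
  have hcrit : ∀ p, IsMCriticalPt (𝓡 4) f p ↔
      orientedNormal o F p = a ∨ orientedNormal o F p = -a :=
    fun p => isMCriticalPt_height_iff_orientedNormal o hF hinj ha p
  have hsign : ∀ (s : ℝ), s = 1 ∨ s = -1 → ∀ p, orientedNormal o F p = s • a →
      LinearMap.det (chartShapeOp o hF hinj p) ≠ 0 ∧
        LinearMap.det (chartShapeOp o hF hinj p) / |LinearMap.det (chartShapeOp o hF hinj p)| =
          (-1 : ℝ) ^ morseIndex (𝓡 4) f p := by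
    intro s hs p hp
    have hap : a = s • orientedNormal o F p := by
      rw [hp, smul_smul]
      rcases hs with rfl | rfl <;> norm_num
    have hpc : IsMCriticalPt (𝓡 4) f p := by
      rw [hcrit]
      rcases hs with rfl | rfl
      · left; rw [hp, one_smul]
      · right; rw [hp, neg_one_smul]
    exact det_chartShapeOp_sign o hF hinj hs hap (hMorse.nondegenerate hpc)
  -- Step 3: the local degree formula over the pole `s • a`
  have hdeg : ∀ (s : ℝ) (hs : s = 1 ∨ s = -1),
      ∃ (T : Finset X), (∀ p, p ∈ T ↔ orientedNormal o F p = s • a) ∧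
        d = ∑ p ∈ T, (-1 : ℤ) ^ morseIndex (𝓡 4) f p := by
    intro s hs
    set y : 𝕊⁴ := ⟨s • a, hamem s hs⟩ with hy
    set Fy : Set X := {p | nuS p = y} with hFy
    have hFy' : ∀ p, p ∈ Fy ↔ orientedNormal o F p = s • a := fun p => by
      rw [hFy, Set.mem_setOf_eq]
      exact ⟨fun h => congrArg Subtype.val h, fun h => Subtype.ext h⟩
    -- injectivity opens around the fibre points
    have hop : ∀ p ∈ Fy, ∃ U : Opens X, p ∈ U ∧ Function.Injective (nuS ∘ (Subtype.val : U → X)) :=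
      fun p hp => exists_opens_injective_gauss o hF hinj oS hoS p (hsign s hs p ((hFy' p).1 hp)).1
    choose! Uo hpUo hinjUo using hop
    -- the fibre is finite
    have hFin : Fy.Finite := by
      refine Set.finite_of_forall_isolated ?_ fun p hp => ⟨(Uo p : Set X), (Uo p).isOpen,
        hpUo p hp, fun q hq hqU => ?_⟩
      · exact (isClosed_singleton.preimage (contMDiff_gaussSph o hF hinj).continuous).isCompact
      · have h := @hinjUo p hp ⟨q, hqU⟩ ⟨p, hpUo p hp⟩ (by
          show nuS q = nuS p
          rw [show nuS q = y from hq, show nuS p = y from hp])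
        exact congrArg Subtype.val h
    set T : Finset X := hFin.toFinset with hT
    have hTmem : ∀ p, p ∈ T ↔ orientedNormal o F p = s • a := fun p => by
      rw [hT, Set.Finite.mem_toFinset, hFy']
    refine ⟨T, hTmem, ?_⟩
    -- apply the local degree formula with `ι = T`
    have hfib : ∀ x, (⟨nuS, (contMDiff_gaussSph o hF hinj).continuous⟩ : C(X, 𝕊⁴)) x = y ↔
        x ∈ Set.range (fun i : (T : Set X) => (i : X)) := fun x => by
      rw [Subtype.range_coe_subtype]
      show nuS x = y ↔ x ∈ {x | x ∈ T}
      rw [Set.mem_setOf_eq, hT, Set.Finite.mem_toFinset]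
      rfl
    have hvU : ∀ i : (T : Set X), (i : X) ∈ Uo i := fun i =>
      hpUo i ((Set.Finite.mem_toFinset hFin).1 i.2)
    have hmemF : ∀ i : (T : Set X), (i : X) ∈ Fy := fun i => (Set.Finite.mem_toFinset hFin).1 i.2
    have hsep : ∀ i l : (T : Set X), l ≠ i → (l : X) ∉ Uo i := by
      intro i l hli hl
      have h := @hinjUo i (hmemF i) ⟨l, hl⟩ ⟨i, hvU i⟩ (by
        show nuS l = nuS i
        rw [show nuS l = y from hmemF l, show nuS i = y from hmemF i])
      have h' : (l : X) = (i : X) := congrArg (fun z : (Uo (i : X)) => (z : X)) h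
      exact hli (Subtype.ext h')
    have hd' := hd
    rw [hCeq] at hd'
    have key := HasDegree.eq_sum_of_localDegree (Y := 𝕊⁴) μ μS hd' y Subtype.val_injective hfib
      (U := fun i => Uo i) hvU hsep
      (fun i => if LinearMap.det (chartShapeOp o hF hinj i) /
          |LinearMap.det (chartShapeOp o hF hinj i)| = 1 then (1 : ℤ) else -1)
      (fun i => by
        have hinjV : Function.Injective (nuS ∘ (Subtype.val : Uo i → X)) := hinjUo i (hmemF i)
        have hloc := localDegree_gauss o hF hinj oS hoS g μ μS hμ hμS i
          (hsign s hs i ((hFy' i).1 (hmemF i))).1 (Uo i) (hvU i) hinjV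
        refine map_eq_zsmul_localClass_congr rfl (show nuS i = y from hmemF i) _ _ _ _ μS hloc)
    rw [key]
    refine (Finset.sum_coe_sort T (fun p => if LinearMap.det (chartShapeOp o hF hinj p) /
          |LinearMap.det (chartShapeOp o hF hinj p)| = 1 then (1 : ℤ) else -1)).trans ?_
    refine Finset.sum_congr rfl fun p hp => ?_
    rw [(hsign s hs p ((hTmem p).1 hp)).2, ite_neg_one_pow_eq]
  -- Step 4: the Morse count
  obtain ⟨T₁, hT₁, hd₁⟩ := hdeg 1 (Or.inl rfl)
  obtain ⟨T₂, hT₂, hd₂⟩ := hdeg (-1) (Or.inr rfl)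
  have ha0 : a ≠ 0 := fun h => by rw [h, norm_zero] at ha; exact zero_ne_one ha
  have hdisj : Disjoint T₁ T₂ := by
    rw [Finset.disjoint_left]
    intro p hp1 hp2
    rw [hT₁, one_smul] at hp1
    rw [hT₂, neg_one_smul] at hp2
    have h1 : a = -a := hp1.symm.trans hp2
    have h2 : (2 : ℝ) • a = 0 := by
      rw [two_smul]
      nth_rw 2 [h1]
      exact add_neg_cancel a
    exact ha0 ((smul_eq_zero.1 h2).resolve_left two_ne_zero)
  have hC : ∀ p, IsMCriticalPt (𝓡 4) f p ↔ p ∈ T₁ ∪ T₂ := fun p => by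
    rw [hcrit, Finset.mem_union, hT₁, hT₂, one_smul, neg_one_smul]
  have hcount : ∀ k, (criticalSetOfIndex (𝓡 4) f k).ncard =
      ((T₁ ∪ T₂).filter fun p => morseIndex (𝓡 4) f p = k).card := by
    intro k
    have hset : criticalSetOfIndex (𝓡 4) f k = ↑((T₁ ∪ T₂).filter fun p => morseIndex (𝓡 4) f p = k) := by
      ext p
      rw [mem_criticalSetOfIndex, Finset.coe_filter, Set.mem_setOf_eq, hC]
    rw [hset, Set.ncard_coe_finset]
  have hmc := SphereMorseCount.morseCount_eq_relEuler (n := 3) (X := X) hMorse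
  rw [← hmc]
  simp_rw [hcount]
  -- regroup the count by critical points
  have hidx : ∀ p ∈ T₁ ∪ T₂, morseIndex (𝓡 4) f p ∈ Finset.range (3 + 2) := fun p _ => by
    rw [Finset.mem_range]
    have := morseIndex_le_finrank (𝓡 4) f p
    rw [finrank_euclideanSpace_fin] at this
    omega
  have hregroup : ∑ k ∈ Finset.range (3 + 2),
      (-1 : ℤ) ^ k * (((T₁ ∪ T₂).filter fun p => morseIndex (𝓡 4) f p = k).card : ℤ) =
      ∑ p ∈ T₁ ∪ T₂, (-1 : ℤ) ^ morseIndex (𝓡 4) f p := by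
    rw [← Finset.sum_fiberwise_of_maps_to hidx]
    refine Finset.sum_congr rfl fun k _ => ?_
    rw [Finset.sum_congr rfl (g := fun _ => (-1 : ℤ) ^ k) fun p hp => by
      rw [(Finset.mem_filter.1 hp).2], Finset.sum_const, nsmul_eq_mul, mul_comm]
  rw [hregroup, Finset.sum_union hdisj, ← hd₁, ← hd₂]
  ring

end CurvaturaIntegra

/-! ### The discharge -/

section Discharge

open Literature.AlgebraicTopology.Homotopy

/-- **Discharge of the named fact `hasTransversalRotation_of_homotopyEquiv_sphere_four`**
(Eliashberg–Mishachev 1997, §3.3, third paragraph of the proof of Theorem 3.2, for `n = 2`;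
Guillemin–Pollack 1974, Ch. 3 §6 p. 146 and Ch. 4 §9 p. 198 for the two theorems of Hopf it
rests on, both proved: `homotopic_of_hasDegree_of_homotopyEquiv` in the sibling file and
`two_mul_degree_gauss_eq_relEuler` here). [cite: GuilleminPollack1974, Ch. 4 §9 p. 198] -/
theorem hasTransversalRotation_of_homotopyEquiv_sphere_four_holds :
    hasTransversalRotation_of_homotopyEquiv_sphere_four :=
  hasTransversalRotation_of_homotopyEquiv_sphere_four_of_gauss
    fun _ _ _ _ _ _ _ _ hF o oS g μ μS hμ hμS hoS _ hd =>
      two_mul_degree_gauss_eq_relEuler hF.contMDiff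
        (injective_mfderiv_of_isSmoothEmbedding hF) o oS hoS g μ μS hμ hμS (gaussMapEmb o hF)
        (fun _ => rfl) hd

end Discharge

end Literature.Topology.Immersions
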